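import Summits.ResolutionOfSingularities.ResolutionOfSingularities.Theorems.PurelyInseparableDim4Target
import Summits.ResolutionOfSingularities.ResolutionOfSingularities.Theorems.PurelyInseparableDim4NearDim
import HarnessLib

/-!
# [OURS · res-dim4-pi PR-3, frame corollaries] `near_dim = n − 1` read in the cell's typed frame
  `PIDim4` (`State`, `Edge`, `IsPermissibleCentre`, `IsMode1hCentre`, `Step1h`)

Cell `res-dim4-pi` (D-0157 DOOR 2), wave 2, seat `res-dim4-p-3`; sequel of
`PurelyInseparableDim4NearDim.lean` (the `CentreBlowup`-level theorems) stated against the cell's target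
file `PurelyInseparableDim4Target.lean` (TY-0, p646102): class `(4, 1)`, states
`PIDim4.State K = CentreBlowup.CState (Fin 4) K`, edges `PIDim4.Edge q S s s'` (chart `j ∈ S`, point `b`
with `b_j = 0`, equimultiple, new `F ≠ 0`), Hironaka-permissible coordinate centres
`PIDim4.IsPermissibleCentre q S F` (`S ≠ ∅ ∧ q ≤ ord_{(x_S)} F`, HP condition (1)) and the MODE-1h centre
of record `PIDim4.IsMode1hCentre` (permissible of least cardinality, WORD #10).

## What is proved (field `K`, any `q`, centre `S`, chart `j ∈ S`, EVERY `b` with `b_j = 0`, state `s` with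
## `2q ≤ ord_{(x_S)} F`)

* `edge_step_of_two_mul_le`: every such `(j, b)` IS an edge `Edge q S s (step q S j b s)` as soon as the
  new `F` is non-zero — the whole exceptional hyperplane of every chart is followed (near_dim = n − 1 = 3).
* `step2_step_of_two_mul_le`, `step0_step_of_two_mul_le`: the same edge as a MODE-2 step, and (for the
  point centre, `2q ≤ ord₀ F`) as a MODE-0 step.
* `isPermissibleCentre_singleton_step`: after the edge the divisor `V(z, x_j)` is a Hironaka-permissible
  coordinate centre of the new state (`F' ∈ (x_j)^q`).
* `card_eq_one_of_isMode1hCentre_step`: hence EVERY MODE-1h centre of the new state is a divisor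
  (`|S'| = 1`): the next MODE-1h edge is a DIV edge — WORD #14 (c)'s «near(exc) artefact … removed by the
  next DIV step», as a theorem of the frame.
* `step1h_next_centre_card_eq_one`: the same phrased on two consecutive MODE-1h steps
  `Step1h q s s' → Step1h q s' s''` read through their centres: if the first centre `S` has
  `2q ≤ ord_{(x_S)} F(s)`, the second has cardinality `1`.
* `isPermissibleCentre_of_two_mul_le`: bookkeeping — `2q ≤ ord_S F` makes `S` itself permissible.

[OURS · counted 0 · corollaries of `PurelyInseparableDim4NearDim` in the cell's frame; AI kernel work,
weaker than expert review.]  Nothing here is a statement about resolution of singularities; resolution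
in dimension `≥ 4` / characteristic `p > 0` is NOT proved by anything in this file.  Host item (DR-157-C):
`stmt-ResolutionOfSingularities-16155`, helper.
-/

noncomputable section

set_option linter.dupNamespace false -- mandated namespace of this single-conjunct summit

open MvPolynomial Finset
open scoped BigOperators

namespace Summit.ResolutionOfSingularities.ResolutionOfSingularities.Theorems.PIDim4.NearDim

open Literature.AlgebraicGeometry.Resolution
open Literature.AlgebraicGeometry.Resolution.CentreBlowup

variable {K : Type} [Field K] [DecidableEq K]

omit [DecidableEq K] in
/-- `2q ≤ ord_{(x_S)} F` and `S ≠ ∅` make `S` a Hironaka-permissible coordinate centre (`q ≤ 2q`).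
OURS (bookkeeping). [cite: HauserPerlega2019PRIMS, §2 (condition (1) f ∈ P^{c!})] -/
theorem isPermissibleCentre_of_two_mul_le {q : ℕ} {S : Finset (Fin 4)} (hS : S.Nonempty)
    {F : MvPolynomial (Fin 4) K} (hF : ((2 * q : ℕ) : ℕ∞) ≤ ordAlong S F) :
    IsPermissibleCentre q S F :=
  ⟨hS, le_trans (by exact_mod_cast Nat.le_mul_of_pos_left q Nat.two_pos) hF⟩

/-- **Every point of the exceptional hyperplane is followed.** If `2q ≤ ord_{(x_S)} F(s)`, then for every
chart `j ∈ S` and EVERY `b` with `b_j = 0` the pair `(j, b)` is an edge of the frame,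
`Edge q S s (step q S j b s)`, provided only that the new residual polynomial is non-zero (the frame's
non-degeneracy clause): the near locus is the whole exceptional divisor, `near_dim = 3`.
OURS (corollary of `isEquimultiplePoint_of_two_mul_le_ordAlong`). [cite: Hauser2010, §F (equiconstant points)] -/
theorem edge_step_of_two_mul_le {q : ℕ} {S : Finset (Fin 4)} {j : Fin 4} (hj : j ∈ S) {b : Fin 4 → K}
    (hbj : b j = 0) {s : State K} (hF : ((2 * q : ℕ) : ℕ∞) ≤ ordAlong S s.F)
    (hne : (step q S j b s).F ≠ 0) : Edge q S s (step q S j b s) :=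
  ⟨j, b, hj, hbj, isEquimultiplePoint_of_two_mul_le_ordAlong j hbj hF, hne, rfl⟩

/-- The same edge is a MODE-2 step (any Hironaka-permissible centre: `S ∋ j` is permissible since
`q ≤ 2q ≤ ord_{(x_S)} F`) … OURS (bookkeeping). [cite: HauserPerlega2019PRIMS, §2 (permissible blowups)] -/
theorem step2_step_of_two_mul_le {q : ℕ} {S : Finset (Fin 4)} {j : Fin 4} (hj : j ∈ S) {b : Fin 4 → K}
    (hbj : b j = 0) {s : State K} (hF : ((2 * q : ℕ) : ℕ∞) ≤ ordAlong S s.F)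
    (hne : (step q S j b s).F ≠ 0) : Step2 q s (step q S j b s) :=
  ⟨S, isPermissibleCentre_of_two_mul_le ⟨j, hj⟩ hF, edge_step_of_two_mul_le hj hbj hF hne⟩

/-- … and, for the point centre (`S` = all four variables, `2q ≤ ord₀ F`), a MODE-0 step: under the POINT
blow-up of a state with `ord₀ F ≥ 2q` every point of every chart's exceptional hyperplane is followed.
OURS (bookkeeping). [cite: Hauser2010, §F (equiconstant points)] -/
theorem step0_step_of_two_mul_le {q : ℕ} {j : Fin 4} {b : Fin 4 → K} (hbj : b j = 0) {s : State K}
    (hF : ((2 * q : ℕ) : ℕ∞) ≤ ordAlong Finset.univ s.F) (hne : (step q Finset.univ j b s).F ≠ 0) :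
    Step0 q s (step q Finset.univ j b s) :=
  ⟨le_trans (by exact_mod_cast Nat.le_mul_of_pos_left q Nat.two_pos) hF,
    edge_step_of_two_mul_le (Finset.mem_univ j) hbj hF hne⟩

/-- **After such an edge the new exceptional divisor `V(z, x_j)` is a Hironaka-permissible coordinate
centre** of the new state: `{j} ≠ ∅` and `q ≤ ord_{(x_j)} F'`. OURS (corollary of
`le_ordAlong_singleton_step_of_two_mul_le`). [cite: HauserPerlega2019PRIMS, §2 (permissible blowups, `ord_P`)] -/
theorem isPermissibleCentre_singleton_step {q : ℕ} {S : Finset (Fin 4)} {j : Fin 4} {b : Fin 4 → K}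
    (hbj : b j = 0) {s : State K} (hF : ((2 * q : ℕ) : ℕ∞) ≤ ordAlong S s.F) :
    IsPermissibleCentre q {j} (step q S j b s).F :=
  ⟨Finset.singleton_nonempty j, le_ordAlong_singleton_step_of_two_mul_le hbj hF⟩

/-- **The next MODE-1h centre is a divisor.** If `2q ≤ ord_{(x_S)} F(s)` then, after the step at any
`b` with `b_j = 0`, EVERY MODE-1h centre `S'` of the new state has `|S'| = 1` (a permissible singleton
exists, and MODE 1h takes least cardinality): the next MODE-1h edge is a DIV edge — the «near(exc)»
artefact is "removed by the next DIV step" (WORD #14 (c)). OURS (census value).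
[cite: HauserPerlega2019PRIMS, §2 (permissible blowups)] -/
theorem card_eq_one_of_isMode1hCentre_step {q : ℕ} {S : Finset (Fin 4)} {j : Fin 4} {b : Fin 4 → K}
    (hbj : b j = 0) {s : State K} (hF : ((2 * q : ℕ) : ℕ∞) ≤ ordAlong S s.F) {S' : Finset (Fin 4)}
    (h1h : IsMode1hCentre q S' (step q S j b s).F) : S'.card = 1 := by
  obtain ⟨⟨hne, -⟩, hmin⟩ := h1h
  have h1 := hmin {j} (isPermissibleCentre_singleton_step hbj hF)
  rw [Finset.card_singleton] at h1
  have h2 := Finset.card_pos.mpr hne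
  omega

/-- **Two consecutive MODE-1h steps.** If `Step1h q s s'` was taken along a centre `S` with
`2q ≤ ord_{(x_S)} F(s)` (the edge datum made explicit: `s' = step q S j b s`, `b_j = 0`), then every
centre available to the next MODE-1h step `Step1h q s' s''` is a divisor. Phrased on the `Edge` witness
of the first step. OURS (census value). [cite: HauserPerlega2019PRIMS, §2 (permissible blowups)] -/
theorem step1h_next_centre_card_eq_one {q : ℕ} {S S' : Finset (Fin 4)} {s s' s'' : State K}
    (hF : ((2 * q : ℕ) : ℕ∞) ≤ ordAlong S s.F) (he : Edge q S s s')
    (h1h : IsMode1hCentre q S' s'.F) (_he' : Edge q S' s' s'') : S'.card = 1 := by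
  obtain ⟨j, b, -, hbj, -, -, rfl⟩ := he
  exact card_eq_one_of_isMode1hCentre_step hbj hF h1h

end Summit.ResolutionOfSingularities.ResolutionOfSingularities.Theorems.PIDim4.NearDim

end
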